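import Mathlib
import Literature.Computability.Complexity.CircuitLightCone
import Literature.Computability.Complexity.CircuitComposition
import Literature.Computability.MetaComplexity.XorBottomModelsAE
import Literature.Computability.MetaComplexity.OliveiraPichSanthanam2019.GapMKtPFormulaXor
import Literature.Computability.MetaComplexity.OliveiraPichSanthanam2019.GapMKtPFormulaBPJuntaBounds
import Literature.Computability.MetaComplexity.GapMCSPLightConeLowerBound
import Literature.Computability.MetaComplexity.MagnificationFrontierBC
import Literature.Computability.MetaComplexity.SearchMCSPJuntaLowerBound
import Literature.Computability.MetaComplexity.ChenJinWilliams2019.SearchMagnificationModels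
import HarnessLib

/-!
# Parity-leaf formulas are AFFINE juntas: `Formula-XOR` / `U₂-Formula-⊕` families of sub-linear
# leaf count versus `Gap-MKtP`, Frontier-B `MCSP`, `search-MCSP` and `search-MKtP` — the KNOWN columns
# of census rows R20, R6 and R52 item 2 (+ its `search-MKtP` twin) in the rows' own models, proved in the tree

Folklore, fully proved (no named facts).  Three magnification rows of the gap census
(`MagnificationGapCensus.lean`) have thresholds in PARITY-LEAF formula models:

* **R20** — Oliveira–Pich–Santhanam, ToC 17(11) 2021, Thm. 1.1 item 2 (`thm11_item2`):
  `Gap-MKtP[2^{βn}, 2^{βn}+cn] ∉ U₂-Formula-⊕[N^{1+ε}]` ⟹ `EXP ⊄ Formula[poly]`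
  (`GapMKtPFormulaXorLB U c (1+ε) β`, class `FORMULAXORae (powSize (1+ε))`);
* **R6** — Chen–Hirahara–Oliveira–Pich–Rajgopal–Santhanam 2020 (CHOPRS), Thm. 24 / Frontier B1
  (`chop_thm24`, `chop_frontierB1`): `MCSP[2^{n^{1/3}}, 2^{n^{2/3}}] ∉ Formula-XOR[N^{1+ε}]`
  ⟹ `NQP ⊄ NC¹` (`MCSPFormulaXorLB ε`, same class);
* **R52 item 2** — Chen–Jin–Williams FOCS 2019, Thm. 1.6 item 2 (`ChenJinWilliams2019.thm16_item2`):
  `search-MCSP[s] ∉ U₂-Formula-⊕[n · poly(s)]` per output bit ⟹ `PSPACE ⊄ Formula[poly]`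
  (`SearchMCSPSolvableAt (formulaXorFns …)`).

For all three the census records MODEL-MISMATCH / PARAM-MISMATCH: print's same-problem bounds are for PLAIN
De Morgan formulas (`Formula[N^{1.99}]`, Hirahara–Santhanam; OPS Thm. 1.3), a proper subclass, and
the one printed `FORMULA[s] ∘ XOR` bound for `MCSP` (Kabanets–Koroth–Lu–Myrisiotis–Oliveira, ToC
2021, Thm. 1(3): `s = Ω̃(n²)`) needs the size parameter `ℓ = n^{Ω(1)}`, not the rows' `2^{o(n)}`
thresholds.  The light-cone / junta device of the census's other KNOWN cells
(`GapMKtPFormulaBPJuntaBounds.lean`, `ApproxMCSPJuntaBounds.lean`, `SearchMCSPJuntaLowerBound.lean`)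
does NOT apply: one parity leaf may read every input.

**The device of this file: a parity-leaf formula with `t` leaves is an AFFINE `t`-junta.**  For ANY
straight-line circuit `C` (`Complexity.Circuit`, no hypothesis on basis, fan-out or wiring) the
output `C.eval x` is a function of the *affine signature* `C.affSig x ∈ {0,1}^{xorLeafCount C}`
(`Circuit.eval_eq_of_affSig_eq`): one bit per parity gate — the parity of the input variables wired
into its slots (`gateInlParity`; slots wired to gates carry values already determined) —, one bit
`x i` per slot of a non-parity gate wired to the variable `i`, and `x i` for an output wire `inl i`;
this list has exactly `C.xorLeafCount` entries (`Circuit.length_affSig`, the parity-leaf count of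
`XorBottomModelsAE.lean`).  The signature is `𝔽₂`-LINEAR: `affSig (x ⊕ w) = affSig x ⊕ affSig w`
bitwise (`Circuit.affSig_xor`).  Hence every fibre of `affSig` is a coset of its kernel, all
non-empty fibres have the same size, and as there are at most `2^t` of them
(`two_pow_card_le_card_image_mul_card_fiber`, pure counting — no linear algebra is imported):

* `Circuit.two_pow_le_card_filter_eval_eq_xorLeafCount` — for every circuit `C` on a finite index
  type and every input `z`, **at least `2^{N - xorLeafCount C}` inputs `x` have `C.eval x = C.eval z`**
  (the affine twin of `Circuit.two_pow_le_card_filter_eval_eq`, light cone ↦ parity-leaf count).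
* `not_solvesPromise_of_xorLeafCount_le`, `not_mem_promiseLift_FamilyAE_of_frequently_xorLeafCount`,
  `not_mem_promiseLift_FORMULAXORae_of_frequently` — the promise-problem consequences, verbatim twins
  of `AtseriasMuller2025.not_solvesPromise_of_card_lt` /
  `OliveiraSanthanam2018.not_mem_promiseLift_FamilyAE_of_frequently`: if infinitely often `P` has a
  YES instance of length `n` and `< 2^{n - t(n)}` non-NO strings of length `n`, then
  `P ∉ promiseLift (FORMULAXORae t)`.
* **Row R20, KNOWN** (`gapMKtP_not_mem_promiseLift_FORMULAXORae`, `gapMKtP_not_mem_FORMULAXORae_sublinear`,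
  `gapMKtPFormulaXorLB_of_lt_one`, `gapMKtP_formulaXor_known_forall`, decision versions
  `MKtP_powLogThreshold_not_mem_FORMULAXORae_sublinear` / `_powSize`): for every `U`, `c`,
  `β ∈ (0,1)` and EVERY `κ < 1`, `GapMKtPFormulaXorLB U c κ β` holds outright (class form:
  `Gap-MKtP[N^β, N^β + c log N] ∉ promiseLift (FORMULAXORae (N − ⌈N^{β'}⌉))`, `β < β' < 1`).  NEEDED
  (`MKtPFormulaXorHypothesis U c`): `κ = 1 + ε` for some `ε > 0` and all small `β`.  Same-model gap:
  exponent `1⁻` known versus `1 + ε` needed — the open part is exactly the exponent interval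
  `[1, 1+ε]` (compare rows R17/R18: `1⁻` versus `2 + ε`).
* **Row R6, KNOWN** (`card_filter_ofFn_not_mem_gapMCSP_no_le`, `gapMCSP_not_mem_promiseLift_FORMULAXORae`,
  `gapMCSP_not_mem_FORMULAXORae_sublinear`, `eventually_frontierBNo_le_noBound`,
  `gapMCSPFrontierB_not_mem_FORMULAXORae_sublinear`, `gapMCSPFrontierB_not_mem_FORMULAXORae_powSize`,
  `mcspFormulaXorLB_of_neg`): `MCSP[2^{n^{1/3}}, 2^{n^{2/3}}] ∉ promiseLift (FORMULAXORae (N − ⌈N^{β'}⌉))`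
  for every `β' ∈ (0,1)`, hence `∉ promiseLift (FORMULAXORae ⌊N^κ⌋)` for every `κ < 1`, i.e.
  `MCSPFormulaXorLB ε` for every `ε < 0`.  NEEDED (Thm. 24 / B1): some `ε > 0` (B1: `ε = 0.01`).
  Same-model gap: exponent `1⁻` versus `1.01` (the sign of `ε`), as for the general-circuit row R3
  (`gapMCSPLowerBound_of_neg`).
* **Row R52 item 2, KNOWN** (`not_searchMCSPSolvableAt_formulaXor`,
  `searchMCSP_formulaXor_known_sublinear`): for every `s` in the regime of CJW Thm. 1.6 there is
  `β₀ < 1` with: for all `β' ∈ (β₀, 1)` and all large `m`, `search-MCSP[s]` is NOT solved with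
  `N − ⌈N^{β'}⌉` parity leaves PER OUTPUT BIT (`N = 2^m`).  NEEDED (`gap_R52_xor`): `N · s(m)^k + k`
  leaves for EVERY `k`; the budgets never cross (`ChenJinWilliams2019.knownBudget_lt_searchBudget`).
* **Row R52, `search-MKtP` item 2 (`C = EXP`), KNOWN** (`not_searchMKtPSolvableAt_formulaXor`,
  `searchMKtP_formulaXor_known_sublinear`, `eventually_not_searchMKtPSolvableAt_formulaXor_powThreshold`):
  the same for `search-MKtP[p]` — for `p` in `KtRegime` with `1^n ∈ MKtP[p]` eventually, and
  unconditionally for `p = ⌊n^β⌋` (`0 < β < β' < 1`), `search-MKtP[p]` is NOT solved with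
  `N − ⌈N^{β'}⌉` parity leaves per output bit at any large length.  NEEDED (`gap_R52_MKtP_xor U`,
  `thm16_MKtP_item2`): `n · p(n)^k + k` leaves for EVERY `k` (formerly "NO K IN MODEL").
* **No ceiling statement.** Unlike the junta cells for `(1,1−δ)-MCSP` (`exists_junta_solves_approxMCSP`)
  the file does not claim the affine-junta count is tight for these problems; it records what the
  device gives: `N − o(N)` leaves, never `N^{1+ε}`.

Covering barrier (locality, recorded not proved): CHOPRS Prop. 43 (`B1^𝒪`:
`MCSP[2^{n^{1/3}}, 2^{n^{2/3}}] ∈ Formula-𝒪-XOR[N^{1.01}]` with local oracles of fan-in `N^{ε}`)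
for R6; the KKLMO remark (ToC 2021, p. 8: "the proof of Theorem 1 Item 3 requires instances where
the parameter ℓ is n^{Ω(1)}") for the printed same-model bound.

References: I. C. Oliveira, J. Pich, R. Santhanam, *Hardness magnification near state-of-the-art
lower bounds*, Theory of Computing 17(11), 2021, Thm. 1.1 item 2, §1.2 [key OliveiraPichSanthanam2021];
L. Chen, S. Hirahara, I. C. Oliveira, J. Pich, N. Rajgopal, R. Santhanam, *Beyond natural proofs:
hardness magnification and locality*, ITCS 2020 / J. ACM 69(4) 2022, arXiv:1911.08297, §1.1 (B1),
Thm. 24, Prop. 43 [key arXiv191108297]; L. Chen, C. Jin, R. Williams, *Hardness magnification for all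
sparse NP languages*, FOCS 2019, Thm. 1.6 item 2 [key ChenJinWilliams2019]; V. Kabanets, S. Koroth,
Z. Lu, D. Myrisiotis, I. C. Oliveira, *Algorithms and lower bounds for De Morgan formulas of
low-communication leaf gates*, Theory of Computing 17 (2021) / CCC 2020, Thm. 1(3) and p. 8
[key KabanetsKorothLuMyrisiotisOliveira2020]; S. Jukna, *Boolean Function Complexity* (2012), §1.4
(counting) and Ch. 6 (leaf size) [key Jukna2012].
-/

open Finset Filter Topology

namespace Literature.Computability.MetaComplexity

open Literature.Computability.Complexity Literature.Computability.Complexity.Circuit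
open Literature.Computability.Complexity.GateList (wireOf vals vals_append_singleton length_vals
  wireOf_inl wireOf_inr circuit_wireVals)

open scoped Classical

variable {ι : Type*}

/-! ### Parities modulo two -/

/-- `#{a | u a ⊕ v a} ≡ #{a | u a} + #{a | v a} (mod 2)`. [folklore] -/
theorem numOnes_xor_mod_two {k : ℕ} (u v : Fin k → Bool) :
    GateFn.numOnes (fun a => xor (u a) (v a)) % 2 = (GateFn.numOnes u + GateFn.numOnes v) % 2 := by
  have key : GateFn.numOnes (fun a => xor (u a) (v a)) +
      2 * #{a : Fin k | u a = true ∧ v a = true} = GateFn.numOnes u + GateFn.numOnes v := by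
    simp only [GateFn.numOnes, Finset.card_filter, Finset.mul_sum, ← Finset.sum_add_distrib]
    refine Finset.sum_congr rfl fun a _ => ?_
    rcases Bool.eq_false_or_eq_true (u a) with hu | hu <;>
      rcases Bool.eq_false_or_eq_true (v a) with hv | hv <;> simp [hu, hv]
  omega

/-- The parity gate functions compute parities: a gate whose gate function lies in `parityGates`
has `op v = [numOnes v odd]`. [folklore] -/
theorem op_eq_of_mem_parityGates {g : Gate ι} (h : g.fn ∈ parityGates) (v : Fin g.arity → Bool) :
    g.op v = decide (GateFn.numOnes v % 2 = 1) := by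
  obtain ⟨k, hk⟩ := h
  obtain ⟨ar, op, args⟩ := g
  simp only [Gate.fn, GateFn.xor, Sigma.mk.inj_iff] at hk
  obtain ⟨rfl, hop⟩ := hk
  rw [← eq_of_heq hop]

/-! ### The affine signature of a straight-line program -/

/-- The literal carried by a wire wired to an input variable: `some (x i)` for `inl i`, nothing for a
gate wire. [folklore] -/
def litOf (x : ι → Bool) : ι ⊕ ℕ → Option Bool
  | .inl i => some (x i)
  | .inr _ => none

/-- `litOf` on an input wire. [folklore] -/
@[simp] theorem litOf_inl (x : ι → Bool) (i : ι) : litOf x (.inl i) = some (x i) := rfl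

/-- `litOf` on a gate wire. [folklore] -/
@[simp] theorem litOf_inr (x : ι → Bool) (m : ℕ) : litOf x (.inr m) = none := rfl

/-- The input-variable part of a wire's value (gate wires read `false`). [folklore] -/
def inlVal (x : ι → Bool) : ι ⊕ ℕ → Bool
  | .inl i => x i
  | .inr _ => false

/-- The gate part of a wire's value (input wires read `false`). [folklore] -/
def inrVal (vs : List Bool) : ι ⊕ ℕ → Bool
  | .inl _ => false
  | .inr m => vs.getD m false

/-- `inlVal` on an input wire. [folklore] -/
@[simp] theorem inlVal_inl (x : ι → Bool) (i : ι) : inlVal x (.inl i) = x i := rfl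

/-- `inlVal` on a gate wire. [folklore] -/
@[simp] theorem inlVal_inr (x : ι → Bool) (m : ℕ) : inlVal x (.inr m : ι ⊕ ℕ) = false := rfl

/-- `inrVal` on an input wire. [folklore] -/
@[simp] theorem inrVal_inl (vs : List Bool) (i : ι) : inrVal vs (.inl i : ι ⊕ ℕ) = false := rfl

/-- `inrVal` on a gate wire. [folklore] -/
@[simp] theorem inrVal_inr (vs : List Bool) (m : ℕ) : inrVal (ι := ι) vs (.inr m) = vs.getD m false := rfl

/-- A wire's value is the XOR of its input part and its gate part (one of them is `false`).
[folklore] -/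
theorem wireOf_eq_xor (x : ι → Bool) (vs : List Bool) (w : ι ⊕ ℕ) :
    wireOf x vs w = xor (inlVal x w) (inrVal vs w) := by
  cases w <;> simp

/-- Bitwise XOR of inputs distributes over `inlVal`. [folklore] -/
theorem inlVal_xor (x w : ι → Bool) (u : ι ⊕ ℕ) :
    inlVal (fun i => xor (x i) (w i)) u = xor (inlVal x u) (inlVal w u) := by
  cases u <;> simp

/-- **The parity leaf of a gate**: the parity of the input variables wired directly into the
argument slots of `g` (with multiplicity; slots wired to gates contribute nothing). [folklore] -/
def gateInlParity (g : Gate ι) (x : ι → Bool) : Bool :=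
  decide (GateFn.numOnes (fun a => inlVal x (g.args a)) % 2 = 1)

/-- **The affine signature of one gate**: for a parity gate the single bit `gateInlParity g x`, for
any other gate the list of input bits on its slots wired to input variables (slot order).
[folklore] -/
noncomputable def gateAffSig (g : Gate ι) (x : ι → Bool) : List Bool :=
  if g.fn ∈ parityGates then [gateInlParity g x] else (List.ofFn g.args).filterMap (litOf x)

/-- **The affine signature of a gate list**: the concatenation of the gate signatures. [folklore] -/
noncomputable def gatesAffSig (gs : List (Gate ι)) (x : ι → Bool) : List Bool :=
  gs.flatMap fun g => gateAffSig g x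

/-- The output part of the signature: the bit `x i` for an output wire `inl i`. [folklore] -/
def outAffSig (x : ι → Bool) : ι ⊕ ℕ → List Bool
  | .inl i => [x i]
  | .inr _ => []

/-- `outAffSig` on an input wire. [folklore] -/
@[simp] theorem outAffSig_inl (x : ι → Bool) (i : ι) : outAffSig x (.inl i) = [x i] := rfl

/-- `outAffSig` on a gate wire. [folklore] -/
@[simp] theorem outAffSig_inr (x : ι → Bool) (m : ℕ) : outAffSig x (.inr m : ι ⊕ ℕ) = [] := rfl

/-- **The affine signature of a circuit** on input `x`: the gate-list signature followed by the
output part.  Deliberate dot-notation extension of `Complexity.Circuit`. [folklore] -/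
noncomputable def _root_.Literature.Computability.Complexity.Circuit.affSig (C : Circuit ι) (x : ι → Bool) :
    List Bool :=
  gatesAffSig C.gates x ++ outAffSig x C.output

/-! ### Lengths: the signature has `xorLeafCount` bits -/

/-- The literal list of a wire list has one entry per input wire. [folklore] -/
theorem length_filterMap_litOf (x : ι → Bool) (l : List (ι ⊕ ℕ)) :
    (l.filterMap (litOf x)).length = l.countP fun w => w.isLeft := by
  induction l with
  | nil => rfl
  | cons w l ih => cases w <;> simp [ih]

/-- Length of a gate signature: `1` for a parity gate, the number of input-wired slots otherwise.
[folklore] -/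
theorem length_gateAffSig (g : Gate ι) (x : ι → Bool) :
    (gateAffSig g x).length =
      if g.fn ∈ parityGates then 1 else (List.ofFn g.args).countP fun w => w.isLeft := by
  unfold gateAffSig
  split_ifs <;> simp [length_filterMap_litOf]

/-- Length of a gate-list signature: the gate part of `Circuit.xorLeafCount`. [folklore] -/
theorem length_gatesAffSig (gs : List (Gate ι)) (x : ι → Bool) :
    (gatesAffSig gs x).length =
      (gs.map fun g =>
        if g.fn ∈ parityGates then 1 else (List.ofFn g.args).countP fun w => w.isLeft).sum := by
  induction gs with
  | nil => rfl
  | cons g gs ih =>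
    simp only [gatesAffSig, List.flatMap_cons, List.length_append, List.map_cons, List.sum_cons] at ih ⊢
    rw [length_gateAffSig, ih]

/-- The output part has `1` bit iff the output wire is an input variable. [folklore] -/
theorem length_outAffSig (x : ι → Bool) (o : ι ⊕ ℕ) :
    (outAffSig x o).length = if o.isLeft then 1 else 0 := by
  cases o <;> rfl

/-- **The affine signature has exactly `xorLeafCount C` bits.** [folklore] -/
theorem _root_.Literature.Computability.Complexity.Circuit.length_affSig (C : Circuit ι)
    (x : ι → Bool) : (C.affSig x).length = C.xorLeafCount := by
  unfold Circuit.affSig Circuit.xorLeafCount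
  rw [List.length_append, length_gatesAffSig, length_outAffSig]

/-! ### Linearity: the signature of `x ⊕ w` is the bitwise XOR of the signatures -/

/-- `gateInlParity` is `𝔽₂`-linear in the input. [folklore] -/
theorem gateInlParity_xor (g : Gate ι) (x w : ι → Bool) :
    gateInlParity g (fun i => xor (x i) (w i)) = xor (gateInlParity g x) (gateInlParity g w) := by
  unfold gateInlParity
  have hsplit : (fun a => inlVal (fun i => xor (x i) (w i)) (g.args a)) =
      fun a => xor (inlVal x (g.args a)) (inlVal w (g.args a)) :=
    funext fun a => inlVal_xor x w (g.args a)
  rw [hsplit, numOnes_xor_mod_two]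
  set A := GateFn.numOnes fun a => inlVal x (g.args a)
  set B := GateFn.numOnes fun a => inlVal w (g.args a)
  rcases Nat.mod_two_eq_zero_or_one A with hA | hA <;>
    rcases Nat.mod_two_eq_zero_or_one B with hB | hB <;> simp [Nat.add_mod, hA, hB]

/-- The literal list is `𝔽₂`-linear in the input (bitwise). [folklore] -/
theorem filterMap_litOf_xor (x w : ι → Bool) (l : List (ι ⊕ ℕ)) :
    l.filterMap (litOf fun i => xor (x i) (w i)) =
      List.zipWith xor (l.filterMap (litOf x)) (l.filterMap (litOf w)) := by
  induction l with
  | nil => rfl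
  | cons u l ih => cases u <;> simp [ih]

/-- A gate signature is `𝔽₂`-linear in the input (bitwise). [folklore] -/
theorem gateAffSig_xor (g : Gate ι) (x w : ι → Bool) :
    gateAffSig g (fun i => xor (x i) (w i)) = List.zipWith xor (gateAffSig g x) (gateAffSig g w) := by
  classical
  unfold gateAffSig
  split_ifs
  · simp [gateInlParity_xor]
  · exact filterMap_litOf_xor x w _

/-- A gate-list signature is `𝔽₂`-linear in the input (bitwise). [folklore] -/
theorem gatesAffSig_xor (gs : List (Gate ι)) (x w : ι → Bool) :
    gatesAffSig gs (fun i => xor (x i) (w i)) =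
      List.zipWith xor (gatesAffSig gs x) (gatesAffSig gs w) := by
  induction gs with
  | nil => rfl
  | cons g gs ih =>
    simp only [gatesAffSig, List.flatMap_cons] at ih ⊢
    rw [List.zipWith_append (by rw [length_gateAffSig, length_gateAffSig]), ← ih, gateAffSig_xor]

/-- **The affine signature is `𝔽₂`-linear**: `affSig (x ⊕ w) = affSig x ⊕ affSig w` bitwise.
[folklore] -/
theorem _root_.Literature.Computability.Complexity.Circuit.affSig_xor (C : Circuit ι)
    (x w : ι → Bool) :
    C.affSig (fun i => xor (x i) (w i)) = List.zipWith xor (C.affSig x) (C.affSig w) := by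
  unfold Circuit.affSig
  rw [List.zipWith_append (by rw [length_gatesAffSig, length_gatesAffSig]), ← gatesAffSig_xor]
  cases C.output <;> simp

/-! ### The signature determines all gate values -/

/-- Equal literal lists force equal input bits on every input wire of the list. [folklore] -/
theorem apply_eq_of_filterMap_litOf_eq {x x' : ι → Bool} {l : List (ι ⊕ ℕ)}
    (h : l.filterMap (litOf x) = l.filterMap (litOf x')) {i : ι} (hi : Sum.inl i ∈ l) :
    x i = x' i := by
  induction l with
  | nil => simp at hi
  | cons u l ih =>
    cases u with
    | inl j =>
      simp only [List.filterMap_cons, litOf_inl, List.cons.injEq] at h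
      rcases List.mem_cons.1 hi with hij | hil
      · cases hij
        exact h.1
      · exact ih h.2 hil
    | inr m =>
      simp only [List.filterMap_cons, litOf_inr] at h
      rcases List.mem_cons.1 hi with hij | hil
      · cases hij
      · exact ih h hil

/-- `gatesAffSig` of an extended program. [folklore] -/
theorem gatesAffSig_append_singleton (gs : List (Gate ι)) (g : Gate ι) (x : ι → Bool) :
    gatesAffSig (gs ++ [g]) x = gatesAffSig gs x ++ gateAffSig g x := by
  simp [gatesAffSig, List.flatMap_append]

/-- **Two inputs with the same affine signature give every gate the same value.** [folklore] -/
theorem vals_eq_of_gatesAffSig_eq (gs : List (Gate ι)) {x x' : ι → Bool}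
    (h : gatesAffSig gs x = gatesAffSig gs x') : vals gs x = vals gs x' := by
  classical
  induction gs using List.reverseRecOn with
  | nil => rfl
  | append_singleton gs g ih =>
    rw [gatesAffSig_append_singleton, gatesAffSig_append_singleton] at h
    obtain ⟨h1, h2⟩ := List.append_inj h (by rw [length_gatesAffSig, length_gatesAffSig])
    have hv := ih h1
    rw [vals_append_singleton, vals_append_singleton, hv]
    congr 2
    by_cases hpar : g.fn ∈ parityGates
    · -- a parity gate: its value is the parity leaf XOR the (equal) gate-wire parity
      simp only [gateAffSig, hpar, if_true, List.cons.injEq, and_true] at h2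
      rw [op_eq_of_mem_parityGates hpar, op_eq_of_mem_parityGates hpar]
      have e : ∀ y : ι → Bool, (fun a => wireOf y (vals gs x') (g.args a)) =
          fun a => xor (inlVal y (g.args a)) (inrVal (vals gs x') (g.args a)) :=
        fun y => funext fun a => wireOf_eq_xor y _ _
      rw [e x, e x', numOnes_xor_mod_two, numOnes_xor_mod_two]
      unfold gateInlParity at h2
      have hmod := decide_eq_decide.1 h2
      apply decide_eq_decide.2
      constructor <;> intro <;> omega
    · -- a non-parity gate: all its input wires carry equal bits
      simp only [gateAffSig, hpar, if_false] at h2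
      congr 1
      funext a
      rcases hw : g.args a with i | m
      · simp only [wireOf_inl]
        exact apply_eq_of_filterMap_litOf_eq h2 (by rw [List.mem_ofFn]; exact ⟨a, hw⟩)
      · simp only [wireOf_inr]

/-- **The affine signature determines the output**: `affSig x = affSig x' → eval x = eval x'`.
[folklore] -/
theorem _root_.Literature.Computability.Complexity.Circuit.eval_eq_of_affSig_eq (C : Circuit ι)
    {x x' : ι → Bool} (h : C.affSig x = C.affSig x') : C.eval x = C.eval x' := by
  unfold Circuit.affSig at h
  obtain ⟨h1, h2⟩ := List.append_inj h (by rw [length_gatesAffSig, length_gatesAffSig])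
  have hv := vals_eq_of_gatesAffSig_eq C.gates h1
  unfold Circuit.eval
  rcases ho : C.output with i | m
  · rw [ho] at h2
    simpa using h2
  · rw [circuit_wireVals, circuit_wireVals, hv]

/-! ### Counting: fibres of an `𝔽₂`-linear map -/

/-- **Fibres of a translation-compatible map are large.** If `φ : {0,1}^ι → τ` satisfies
`φ x = φ x' → φ (x ⊕ w) = φ (x' ⊕ w)` (every `𝔽₂`-affine map does), then all non-empty fibres of
`φ` have the same size, so `2^{|ι|} ≤ |image φ| · |fibre through z|` for every `z`. [folklore] -/
theorem two_pow_card_le_card_image_mul_card_fiber [Fintype ι] [DecidableEq ι] {τ : Type*}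
    [DecidableEq τ] (φ : (ι → Bool) → τ)
    (hφ : ∀ x x' w : ι → Bool, φ x = φ x' →
      φ (fun i => xor (x i) (w i)) = φ (fun i => xor (x' i) (w i)))
    (z : ι → Bool) :
    2 ^ Fintype.card ι ≤ (univ.image φ).card * #{x : ι → Bool | φ x = φ z} := by
  set F := #{x : ι → Bool | φ x = φ z} with hF
  have key : ∀ t ∈ univ.image φ, #{x : ι → Bool | φ x = t} ≤ F := by
    intro t ht
    obtain ⟨x₀, -, rfl⟩ := mem_image.1 ht
    refine card_le_card_of_injOn (fun x i => xor (x i) (xor (x₀ i) (z i))) (fun x hx => ?_)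
      (fun x _ x' _ hxx' => ?_)
    · simp only [coe_filter, mem_univ, true_and, Set.mem_setOf_eq] at hx ⊢
      rw [hφ x x₀ (fun i => xor (x₀ i) (z i)) hx]
      congr 1
      funext i
      cases x₀ i <;> cases z i <;> rfl
    · funext i
      have := congrFun hxx' i
      simp only at this
      cases hxi : x i <;> cases hx'i : x' i <;> cases hx₀ : x₀ i <;> cases hz : z i <;>
        simp [hxi, hx'i, hx₀, hz] at this ⊢
  calc 2 ^ Fintype.card ι = #(univ : Finset (ι → Bool)) := by simp
    _ = ∑ t ∈ univ.image φ, #{x ∈ (univ : Finset (ι → Bool)) | φ x = t} :=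
        card_eq_sum_card_image φ univ
    _ ≤ ∑ t ∈ univ.image φ, F := sum_le_sum key
    _ = (univ.image φ).card * F := by rw [sum_const, smul_eq_mul]

/-- **Parity-leaf formulas are affine juntas — the count.** For EVERY circuit `C` on a finite set
of input variables and every input `z`, at least `2^{|ι| - xorLeafCount C}` inputs `x` satisfy
`C.eval x = C.eval z`: the output is a function of the `𝔽₂`-linear signature `affSig`, which takes
at most `2^{xorLeafCount C}` values and has equal-size fibres. [folklore] -/
theorem _root_.Literature.Computability.Complexity.Circuit.two_pow_le_card_filter_eval_eq_xorLeafCount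
    [Fintype ι] [DecidableEq ι] (C : Circuit ι) (z : ι → Bool) :
    2 ^ (Fintype.card ι - C.xorLeafCount) ≤ #{x : ι → Bool | C.eval x = C.eval z} := by
  set L := C.xorLeafCount with hL
  -- the signature as a vector of the fixed length `L`
  let φ : (ι → Bool) → List.Vector Bool L := fun x => ⟨C.affSig x, C.length_affSig x⟩
  have hφ : ∀ x x' w : ι → Bool, φ x = φ x' →
      φ (fun i => xor (x i) (w i)) = φ (fun i => xor (x' i) (w i)) := by
    intro x x' w h
    have h' : C.affSig x = C.affSig x' := congrArg List.Vector.toList h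
    apply List.Vector.eq
    show C.affSig (fun i => xor (x i) (w i)) = C.affSig (fun i => xor (x' i) (w i))
    rw [C.affSig_xor, C.affSig_xor, h']
  have himg : (univ.image φ).card ≤ 2 ^ L :=
    (card_le_univ _).trans (by rw [card_vector, Fintype.card_bool])
  have hfib : #{x : ι → Bool | φ x = φ z} ≤ #{x : ι → Bool | C.eval x = C.eval z} := by
    refine card_le_card fun x hx => ?_
    simp only [mem_filter, mem_univ, true_and] at hx ⊢
    exact C.eval_eq_of_affSig_eq (congrArg List.Vector.toList hx)
  have hmain : 2 ^ Fintype.card ι ≤ 2 ^ L * #{x : ι → Bool | C.eval x = C.eval z} :=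
    (two_pow_card_le_card_image_mul_card_fiber φ hφ z).trans (Nat.mul_le_mul himg hfib)
  rcases le_or_gt L (Fintype.card ι) with hLN | hLN
  · have hsplit : 2 ^ Fintype.card ι = 2 ^ L * 2 ^ (Fintype.card ι - L) := by
      rw [← pow_add, Nat.add_sub_cancel' hLN]
    rw [hsplit] at hmain
    exact Nat.le_of_mul_le_mul_left hmain (pow_pos two_pos L)
  · rw [Nat.sub_eq_zero_of_le hLN.le, pow_zero]
    exact card_pos.2 ⟨z, by simp⟩

/-! ### Promise problems versus parity-leaf formula families -/

/-- **A circuit with few parity leaves cannot solve a promise problem with a YES instance and few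
non-NO instances** (the affine twin of `AtseriasMuller2025.not_solvesPromise_of_card_lt`): if
`xorLeafCount E ≤ k`, a YES instance of length `n` exists and `< 2^{n-k}` strings of length `n` lie
outside the NO side, then `E` does not solve `P` at length `n`. [folklore] -/
theorem not_solvesPromise_of_xorLeafCount_le {P : PromiseProblem} {n k : ℕ} (E : Circuit (Fin n))
    (hE : E.xorLeafCount ≤ k) (hyes : ∃ y : Fin n → Bool, List.ofFn y ∈ P.yes)
    (hlt : #{z : Fin n → Bool | List.ofFn z ∉ P.no} < 2 ^ (n - k)) : ¬ E.SolvesPromise P := by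
  classical
  intro hsol
  obtain ⟨y, hy⟩ := hyes
  have hEy : E.eval y = true := (hsol y).1 hy
  have h1 : 2 ^ (n - k) ≤ #{z : Fin n → Bool | E.eval z = E.eval y} :=
    calc 2 ^ (n - k) ≤ 2 ^ (Fintype.card (Fin n) - E.xorLeafCount) :=
          Nat.pow_le_pow_right (by norm_num) (by simp only [Fintype.card_fin]; omega)
      _ ≤ _ := E.two_pow_le_card_filter_eval_eq_xorLeafCount y
  have h2 : #{z : Fin n → Bool | E.eval z = E.eval y} ≤ #{z : Fin n → Bool | List.ofFn z ∉ P.no} := by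
    refine card_le_card fun z hz => ?_
    simp only [mem_filter, mem_univ, true_and] at hz ⊢
    intro hno
    have := (hsol z).2 hno
    rw [hz, hEy] at this
    exact Bool.noConfusion this
  exact absurd (h1.trans h2) (not_le.2 hlt)

/-- **A.e. families with few parity leaves** (the affine twin of
`OliveiraSanthanam2018.not_mem_promiseLift_FamilyAE_of_frequently`): if every constrained circuit at
length `n` has `xorLeafCount ≤ k n`, and infinitely often `P` has a YES instance of length `n` and
`< 2^{n - k(n)}` non-NO strings of length `n`, then `P ∉ promiseLift (FamilyAE Q)`. [folklore] -/
theorem not_mem_promiseLift_FamilyAE_of_frequently_xorLeafCount {P : PromiseProblem}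
    {Q : ∀ n : ℕ, Circuit (Fin n) → Prop} {k : ℕ → ℕ}
    (hQ : ∀ n (C : Circuit (Fin n)), Q n C → C.xorLeafCount ≤ k n)
    (h : ∃ᶠ n : ℕ in atTop, (∃ y : Fin n → Bool, List.ofFn y ∈ P.yes) ∧
      #{z : Fin n → Bool | List.ofFn z ∉ P.no} < 2 ^ (n - k n)) :
    P ∉ promiseLift (FamilyAE Q) := by
  rintro ⟨L, ⟨C, ⟨n₀, hC⟩, hdec⟩, hyes, hno⟩
  obtain ⟨n, hn₀, hy, hlt⟩ := frequently_atTop.1 h n₀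
  refine not_solvesPromise_of_xorLeafCount_le (C n) (hQ n _ (hC n hn₀)) hy hlt fun u => ?_
  rw [hdec.eval_eq u]
  exact ⟨fun hu => (Set.mem_iff_boolIndicator _ _).1 (hyes hu),
    fun hu => (Set.notMem_iff_boolIndicator _ _).1 (hno hu)⟩

/-- **`Formula-XOR[t]` / `U₂-Formula-⊕[t]` families** (`FORMULAXORae t`, parity-leaf count `≤ t n`
a.e.): if infinitely often `P` has a YES instance of length `n` and `< 2^{n - t(n)}` non-NO strings
of length `n`, then `P ∉ promiseLift (FORMULAXORae t)`. [folklore] -/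
theorem not_mem_promiseLift_FORMULAXORae_of_frequently {P : PromiseProblem} {t : ℕ → ℕ}
    (h : ∃ᶠ n : ℕ in atTop, (∃ y : Fin n → Bool, List.ofFn y ∈ P.yes) ∧
      #{z : Fin n → Bool | List.ofFn z ∉ P.no} < 2 ^ (n - t n)) :
    P ∉ promiseLift (FORMULAXORae t) :=
  not_mem_promiseLift_FamilyAE_of_frequently_xorLeafCount (fun _ _ hC => hC.2.2.2) h

/-! ### Row R20: `Gap-MKtP[2^{βn}, 2^{βn}+cn]` against `U₂-Formula-⊕` -/

namespace OliveiraPichSanthanam2019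

/-- **`Gap-MKtP[s₁, s₂]` against parity-leaf formulas (family form).** If at infinitely many
lengths `N` some string of length `N` has `Kt ≤ s₁ N` and `s₂ N + s N + 1 ≤ N`, then
`Gap-MKtP[s₁, s₂] ∉ promiseLift (FORMULAXORae s)` (`gapMKtP_count`). [folklore] -/
theorem gapMKtP_not_mem_promiseLift_FORMULAXORae (U : UniversalMachine) {s₁ s₂ s : ℕ → ℕ}
    (h : ∃ᶠ N : ℕ in atTop, (∃ y : List Bool, y.length = N ∧ U.levinKt y ≤ s₁ N) ∧
      s₂ N + s N + 1 ≤ N) :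
    U.gapMKtP s₁ s₂ ∉ promiseLift (FORMULAXORae s) :=
  not_mem_promiseLift_FORMULAXORae_of_frequently
    (h.mono fun _ hN => gapMKtP_count U s₁ s₂ s hN.1 hN.2)

/-- **Row R20, KNOWN (class form)**: `Gap-MKtP[⌊N^β⌋, ⌊N^β + c·log₂ N⌋] ∉ promiseLift (FORMULAXORae
(N ↦ N − ⌈N^{β'}⌉))` for `0 < β < β' < 1` — no language consistent with the promise has a.e.
parity-leaf formulas with `N − ⌈N^{β'}⌉` leaves. [folklore] -/
theorem gapMKtP_not_mem_FORMULAXORae_sublinear (U : UniversalMachine) (c : ℕ) {β β' : ℝ}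
    (hβ : 0 < β) (hββ' : β < β') (hβ'1 : β' < 1) :
    U.gapMKtP (UniversalMachine.powThreshold β) (UniversalMachine.powLogThreshold β c) ∉
      promiseLift (FORMULAXORae fun N => N - ⌈(N : ℝ) ^ β'⌉₊) :=
  gapMKtP_not_mem_promiseLift_FORMULAXORae U (frequently_gapMKtP_threshold_hypothesis U c hβ hββ' hβ'1)

/-- **Row R20, KNOWN column, in the vocabulary of OPS Theorem 1.1 item 2.** For every `U`, `c`,
`β ∈ (0, 1)` and EVERY `κ < 1`: `GapMKtPFormulaXorLB U c κ β` (`Gap-MKtP[2^{βn}, 2^{βn}+cn] ∉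
U₂-Formula-⊕[N^κ]`), unconditionally; the row NEEDS `κ = 1 + ε` for some `ε > 0`
(`MKtPFormulaXorHypothesis U c`).  The same-model gap is the exponent: `1⁻` proved versus `1 + ε`
needed; print has no `U₂-Formula-⊕` bound for `MKtP` at these parameters.
[cite: OliveiraPichSanthanam2021, Thm. 1.1 item 2 (hypothesis shape; folklore known bound)] -/
theorem gapMKtPFormulaXorLB_of_lt_one (U : UniversalMachine) (c : ℕ) {κ β : ℝ} (hκ : κ < 1)
    (hβ : 0 < β) (hβ1 : β < 1) : GapMKtPFormulaXorLB U c κ β := by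
  obtain ⟨β', hββ', hκβ', hβ'1⟩ := exists_exponent_between hβ1 hκ
  intro hmem
  exact gapMKtP_not_mem_FORMULAXORae_sublinear U c hβ hββ' hβ'1
    (promiseLift_mono (FORMULAXORae_mono (eventually_powSize_le_sub_ceil hκβ' (hβ.trans hββ') hβ'1))
      hmem)

/-- The `∃ β₀ ∀ β < β₀` form matching the row's quantifier shape (`β₀ = 1`): for every `κ < 1`,
`MKtPFormulaXorHypothesis U c` with `1 + ε` replaced by `κ` holds outright.
[cite: OliveiraPichSanthanam2021, Thm. 1.1 item 2 (hypothesis shape; folklore known bound)] -/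
theorem gapMKtP_formulaXor_known_forall (U : UniversalMachine) (c : ℕ) {κ : ℝ} (hκ : κ < 1) :
    ∃ β₀ : ℝ, 0 < β₀ ∧ ∀ β : ℝ, 0 < β → β < β₀ → GapMKtPFormulaXorLB U c κ β :=
  ⟨1, one_pos, fun _ hβ hβ1 => gapMKtPFormulaXorLB_of_lt_one U c hκ hβ hβ1⟩

/-- **Decision version**: `MKtP[⌊N^β + c·log₂ N⌋] ∉ FORMULAXORae (N − ⌈N^{β'}⌉)` for
`0 < β < β' < 1`. [folklore] -/
theorem MKtP_powLogThreshold_not_mem_FORMULAXORae_sublinear (U : UniversalMachine) (c : ℕ)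
    {β β' : ℝ} (hβ : 0 < β) (hββ' : β < β') (hβ'1 : β' < 1) :
    U.MKtP (UniversalMachine.powLogThreshold β c) ∉ FORMULAXORae fun N => N - ⌈(N : ℝ) ^ β'⌉₊ :=
  fun hmem => gapMKtP_not_mem_FORMULAXORae_sublinear U c hβ hββ' hβ'1
    (U.gapMKtP_mem_promiseLift_of_MKtP_mem
      (fun N => powThreshold_le_powLogThreshold β c N) hmem)

/-- **Decision version in exponent form**: for every `κ < 1` and `β ∈ (0, 1)`, the language
`MKtP[⌊N^β + c·log₂ N⌋]` has no a.e. parity-leaf formulas with `⌊N^κ⌋` leaves. [folklore] -/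
theorem MKtP_powLogThreshold_not_mem_FORMULAXORae_powSize (U : UniversalMachine) (c : ℕ) {κ β : ℝ}
    (hκ : κ < 1) (hβ : 0 < β) (hβ1 : β < 1) :
    U.MKtP (UniversalMachine.powLogThreshold β c) ∉ FORMULAXORae (powSize κ) :=
  fun hmem => gapMKtPFormulaXorLB_of_lt_one U c hκ hβ hβ1
    (U.gapMKtP_mem_promiseLift_of_MKtP_mem
      (fun N => powThreshold_le_powLogThreshold β c N) hmem)

end OliveiraPichSanthanam2019

/-! ### Row R6: Frontier-B `MCSP[2^{n^{1/3}}, 2^{n^{2/3}}]` against `Formula-XOR` -/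

open Literature.Computability.MetaComplexity.OliveiraPichSanthanam2019 (powSize exists_exponent_between)

/-- **Few strings of length `2ⁿ` lie outside the NO side of `MCSP[a, b]`**: they tabulate functions
of complexity `≤ b n`, of which there are at most `(b+1)(16(n+b+1)²)ᵇ(n+b+1)` (`b = b n`,
`card_filter_circuitSizeOver_le`). [folklore] -/
theorem card_filter_ofFn_not_mem_gapMCSP_no_le (a b : ℕ → ℕ) (n : ℕ) :
    #{z : Fin (2 ^ n) → Bool | List.ofFn z ∉ (gapMCSP a b).no} ≤
      (b n + 1) * (16 * (n + b n + 1) ^ 2) ^ b n * (n + b n + 1) := by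
  classical
  let tbl : (Fin (2 ^ n) → Bool) → ((Fin n → Bool) → Bool) := fun x v => x (boolFunEquivFin n v)
  have htbl_inj : Function.Injective tbl := by
    intro x x' h
    funext i
    have := congrFun h ((boolFunEquivFin n).symm i)
    simpa [tbl] using this
  have htbl_tt : ∀ x, truthTable (tbl x) = List.ofFn x := by
    intro x
    simp [truthTable, tbl]
  calc #{z : Fin (2 ^ n) → Bool | List.ofFn z ∉ (gapMCSP a b).no}
      ≤ #{f : (Fin n → Bool) → Bool | circuitSizeOver B2 f ≤ b n} := by
        refine card_le_card_of_injOn tbl (fun x hx => ?_) htbl_inj.injOn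
        simp only [coe_filter, Set.mem_setOf_eq, mem_univ, true_and] at hx ⊢
        by_contra hlt
        exact hx (by rw [← htbl_tt, truthTable_mem_gapMCSP_no_iff]; exact not_le.1 hlt)
    _ ≤ _ := card_filter_circuitSizeOver_le n (b n)

/-- At every `n ≥ 1` the gap problem `MCSP[a, b]` has a YES instance of length `2ⁿ`: the truth table
of the projection `v ↦ v 0` (complexity `0`). [folklore] -/
theorem exists_ofFn_mem_gapMCSP_yes (a b : ℕ → ℕ) {n : ℕ} (hn : 1 ≤ n) :
    ∃ y : Fin (2 ^ n) → Bool, List.ofFn y ∈ (gapMCSP a b).yes := by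
  refine ⟨fun i => (fun v : Fin n → Bool => v ⟨0, hn⟩) ((boolFunEquivFin n).symm i), ?_⟩
  rw [show (List.ofFn fun i => (fun v : Fin n → Bool => v ⟨0, hn⟩) ((boolFunEquivFin n).symm i)) =
      truthTable (fun v : Fin n → Bool => v ⟨0, hn⟩) from rfl, gapMCSP_yes, truthTable_mem_MCSPSize_iff]
  exact (circuitSizeOver_le_of_computes (f := fun v : Fin n → Bool => v ⟨0, hn⟩)
    (Circuit.input (⟨0, hn⟩ : Fin n)) (fun g hg => by cases hg) (fun _ => rfl)).trans (by simp)

/-- **`MCSP[a, b]` against parity-leaf formulas (family form).** If for infinitely many `n` the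
circuit count at `b n` is `< 2^{2ⁿ - t(2ⁿ)}`, then `MCSP[a, b] ∉ promiseLift (FORMULAXORae t)`.
[folklore] -/
theorem gapMCSP_not_mem_promiseLift_FORMULAXORae {a b t : ℕ → ℕ}
    (h : ∃ᶠ n : ℕ in atTop,
      (b n + 1) * (16 * (n + b n + 1) ^ 2) ^ b n * (n + b n + 1) < 2 ^ (2 ^ n - t (2 ^ n))) :
    gapMCSP a b ∉ promiseLift (FORMULAXORae t) := by
  refine not_mem_promiseLift_FORMULAXORae_of_frequently (frequently_atTop.2 fun N₀ => ?_)
  obtain ⟨n, hn, hlt⟩ := frequently_atTop.1 h (max N₀ 1)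
  have hn1 : 1 ≤ n := (le_max_right _ _).trans hn
  refine ⟨2 ^ n, (le_max_left _ _).trans (hn.trans n.lt_two_pow_self.le),
    exists_ofFn_mem_gapMCSP_yes a b hn1, ?_⟩
  exact (card_filter_ofFn_not_mem_gapMCSP_no_le a b n).trans_lt hlt

/-- **`MCSP[a, b]` with `b n ≤ ⌈2^{βn}⌉` eventually is not separated by parity-leaf formulas with
`N − ⌈N^{β'}⌉` leaves**, for `0 ≤ β < β' < 1` and any YES threshold `a`
(`eventually_circuitCount_noBound_lt`). [folklore] -/
theorem gapMCSP_not_mem_FORMULAXORae_sublinear {a b : ℕ → ℕ} {β β' : ℝ} (hβ : 0 ≤ β) (hββ' : β < β')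
    (hβ'1 : β' < 1) (hb : ∀ᶠ n : ℕ in atTop, b n ≤ OliveiraPichSanthanam2019.noBound β n) :
    gapMCSP a b ∉ promiseLift (FORMULAXORae fun N => N - ⌈(N : ℝ) ^ β'⌉₊) := by
  refine gapMCSP_not_mem_promiseLift_FORMULAXORae (Eventually.frequently ?_)
  filter_upwards [eventually_circuitCount_noBound_lt hβ hββ' hβ'1, hb] with n hn hbn
  exact ((circuitCount_mono n hbn).trans_lt hn).trans_le
    (Nat.pow_le_pow_right (by norm_num) (Nat.sub_le _ 1))

/-- The Frontier-B NO threshold is sub-exponential: for every `β > 0`, eventually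
`⌊2^{n^{2/3}}⌋ ≤ ⌈2^{βn}⌉` (`n^{2/3} ≤ βn` once `n ≥ β⁻³`). [folklore] -/
theorem eventually_frontierBNo_le_noBound {β : ℝ} (hβ : 0 < β) :
    ∀ᶠ n : ℕ in atTop, frontierBNo n ≤ OliveiraPichSanthanam2019.noBound β n := by
  refine (eventually_ge_atTop ⌈(1 / β) ^ 3⌉₊).mono fun n hn => ?_
  have hn' : (1 / β) ^ 3 ≤ (n : ℝ) := (Nat.le_ceil _).trans (by exact_mod_cast hn)
  have hn0 : (0 : ℝ) ≤ n := Nat.cast_nonneg n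
  -- `t = n^{1/3}`, `t³ = n`, `t² = n^{2/3}`
  set t : ℝ := (n : ℝ) ^ (1 / 3 : ℝ) with ht
  have ht0 : 0 ≤ t := Real.rpow_nonneg hn0 _
  have ht3 : t ^ 3 = n := by
    rw [ht, ← Real.rpow_natCast, ← Real.rpow_mul hn0]; norm_num
  have ht2 : t ^ 2 = (n : ℝ) ^ (2 / 3 : ℝ) := by
    rw [ht, ← Real.rpow_natCast, ← Real.rpow_mul hn0]; norm_num
  have hβt : 1 ≤ β * t := by
    have h1 : 1 / β ≤ t := by
      rw [← ht3] at hn'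
      exact (pow_le_pow_iff_left₀ (by positivity) ht0 (by norm_num)).1 hn'
    have := mul_le_mul_of_nonneg_left h1 hβ.le
    rwa [mul_one_div_cancel hβ.ne'] at this
  have hexp : (n : ℝ) ^ (2 / 3 : ℝ) ≤ β * n := by
    rw [← ht2, ← ht3]
    calc t ^ 2 = 1 * t ^ 2 := (one_mul _).symm
      _ ≤ (β * t) * t ^ 2 := mul_le_mul_of_nonneg_right hβt (sq_nonneg t)
      _ = β * t ^ 3 := by ring
  unfold frontierBNo OliveiraPichSanthanam2019.noBound
  exact (Nat.floor_le_floor (Real.rpow_le_rpow_of_exponent_le one_le_two hexp)).trans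
    (Nat.floor_le_ceil _)

/-- **Row R6, KNOWN (class form)**: `MCSP[2^{n^{1/3}}, 2^{n^{2/3}}] ∉ promiseLift (FORMULAXORae
(N ↦ N − ⌈N^{β'}⌉))` for every `β' ∈ (0, 1)`. [folklore] -/
theorem gapMCSPFrontierB_not_mem_FORMULAXORae_sublinear {β' : ℝ} (hβ'0 : 0 < β') (hβ'1 : β' < 1) :
    gapMCSPFrontierB ∉ promiseLift (FORMULAXORae fun N => N - ⌈(N : ℝ) ^ β'⌉₊) :=
  gapMCSP_not_mem_FORMULAXORae_sublinear (β := β' / 2) (by linarith) (by linarith) hβ'1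
    (eventually_frontierBNo_le_noBound (by linarith))

/-- **Row R6, KNOWN (exponent form)**: `MCSP[2^{n^{1/3}}, 2^{n^{2/3}}] ∉ promiseLift (FORMULAXORae
⌊N^κ⌋)` for every `κ < 1`. [folklore] -/
theorem gapMCSPFrontierB_not_mem_FORMULAXORae_powSize {κ : ℝ} (hκ : κ < 1) :
    gapMCSPFrontierB ∉ promiseLift (FORMULAXORae (powSize κ)) := by
  obtain ⟨β', h12, hκβ', hβ'1⟩ := exists_exponent_between (β := 1 / 2) (by norm_num) hκ
  have hβ'0 : 0 < β' := by linarith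
  exact fun hmem => gapMCSPFrontierB_not_mem_FORMULAXORae_sublinear hβ'0 hβ'1
    (promiseLift_mono (FORMULAXORae_mono (eventually_powSize_le_sub_ceil hκβ' hβ'0 hβ'1)) hmem)

/-- **Row R6, KNOWN column, in the vocabulary of CHOPRS Theorem 24 / B1.** `MCSPFormulaXorLB ε`
(`MCSP[2^{n^{1/3}}, 2^{n^{2/3}}] ∉ Formula-XOR[N^{1+ε}]`) HOLDS for every `ε < 0`; Theorem 24 needs
it for SOME `ε > 0`, B1 (`FrontierB1Hypothesis`) at `ε = 0.01`.  The same-model gap is the sign of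
`ε` (exponent `1⁻` known versus `1.01` needed); print's `Formula[N^{1.99}]` (B4) is for plain
formulas and KKLMO's `FORMULA[Ω̃(n²)] ∘ XOR` needs `ℓ = n^{Ω(1)}`.
[cite: arXiv191108297, Thm. 24 and §1.1 B1 (hypothesis shape; folklore known bound)] -/
theorem mcspFormulaXorLB_of_neg {ε : ℝ} (hε : ε < 0) : MCSPFormulaXorLB ε :=
  gapMCSPFrontierB_not_mem_FORMULAXORae_powSize (by linarith)

/-! ### Row R52 item 2: `search-MCSP[s]` against `U₂-Formula-⊕` per output bit -/

namespace ChenJinWilliams2019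

open Literature.Computability.MetaComplexity.ChenJinWilliams2020 (sliceFn circuitFns)

/-- **`search-MCSP[s]` is not solved at `m ≥ 1` with parity-leaf formulas of `t(2^m)` leaves per
output bit when the count at `s(m)` is `< 2^{2^m - t(2^m)}`**: output `0` would be a circuit with
`≤ t(2^m)` parity leaves computing the `MCSP[s]` indicator, whose fibre through the truth table of a
projection consists of `≥ 2^{2^m - t(2^m)}` non-NO instances of `MCSP[s, s]`. [folklore] -/
theorem not_searchMCSPSolvableAt_formulaXor {s t : ℕ → ℕ} {m : ℕ} (hm : 1 ≤ m)
    (h : (s m + 1) * (16 * (m + s m + 1) ^ 2) ^ s m * (m + s m + 1) < 2 ^ (2 ^ m - t (2 ^ m))) :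
    ¬ SearchMCSPSolvableAt (formulaXorFns t) s m := by
  classical
  intro hS
  obtain ⟨C, hC, hCf⟩ := sliceFn_mem_of_searchMCSPSolvableAt hS
  obtain ⟨y, hy⟩ := exists_ofFn_mem_gapMCSP_yes s s hm
  have hfy : sliceFn (MCSPSize s) (2 ^ m) y = true := (Set.mem_iff_boolIndicator _ _).1 hy
  have h1 : 2 ^ (2 ^ m - t (2 ^ m)) ≤ #{x : Fin (2 ^ m) → Bool | C.eval x = C.eval y} :=
    calc 2 ^ (2 ^ m - t (2 ^ m)) ≤ 2 ^ (Fintype.card (Fin (2 ^ m)) - C.xorLeafCount) :=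
          Nat.pow_le_pow_right (by norm_num) (by simp only [Fintype.card_fin]; have := hC.2.2.2; omega)
      _ ≤ _ := C.two_pow_le_card_filter_eval_eq_xorLeafCount y
  have h2 : #{x : Fin (2 ^ m) → Bool | C.eval x = C.eval y} ≤
      #{x : Fin (2 ^ m) → Bool | List.ofFn x ∉ (gapMCSP s s).no} := by
    refine card_le_card fun x hx => ?_
    simp only [mem_filter, mem_univ, true_and] at hx ⊢
    rw [hCf x, hCf y, hfy] at hx
    have hxyes : List.ofFn x ∈ (gapMCSP s s).yes := (Set.mem_iff_boolIndicator _ _).2 hx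
    exact Set.disjoint_left.1 (gapMCSP_disjoint (a := s) (b := s) fun _ => le_rfl) hxyes
  exact absurd ((h1.trans h2).trans (card_filter_ofFn_not_mem_gapMCSP_no_le s s m)) (not_le.2 h)

/-- **Row R52 item 2, KNOWN side in the same model.** For every `s` in the regime of Thm. 1.6 there
is `β₀ < 1` such that for every `β' ∈ (β₀, 1)`, `search-MCSP[s]` is not solved with `N − ⌈N^{β'}⌉`
parity leaves per output bit at any large `m` (item 2 needs `N · s(m)^k + k` leaves for every `k`;
`knownBudget_lt_searchBudget`). [cite: ChenJinWilliams2019, Thm. 1.6 item 2 (hypothesis shape; known side folklore)] -/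
theorem searchMCSP_formulaXor_known_sublinear {s : ℕ → ℕ} (hs : SizeRegime s) :
    ∃ β₀ : ℝ, β₀ < 1 ∧ ∀ β' : ℝ, β₀ < β' → β' < 1 → ∀ᶠ m : ℕ in atTop,
      ¬ SearchMCSPSolvableAt (formulaXorFns fun N => N - ⌈(N : ℝ) ^ β'⌉₊) s m := by
  obtain ⟨β, hβ0, hβ1, hev⟩ := hs.exists_eventually_le_noBound
  refine ⟨β, hβ1, fun β' hββ' hβ'1 => ?_⟩
  filter_upwards [eventually_circuitCount_lt_two_pow_sub_sublinear hβ0 hββ' hβ'1 hev,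
    eventually_ge_atTop 1] with m hm hm1
  exact not_searchMCSPSolvableAt_formulaXor hm1 hm


/-! ### Row R52-MKtP item 2: `search-MKtP[p]` against `U₂-Formula-⊕` per output bit -/

/-- **Single-length form.** If `1^n ∈ MKtP[p]` and `p(n) + t(n) + 1 ≤ n`, then `search-MKtP[p]` is
not solved at length `n` by tuples of functions each having a parity-leaf formula (indeed any
circuit) with `≤ t(n)` parity leaves: output `0` would solve `Gap-MKtP[p, p]` at length `n`, so its
fibre through `1^n` — at least `2^{n − t(n)}` strings (`two_pow_le_card_filter_eval_eq_xorLeafCount`)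
— would consist of strings with `Kt ≤ p(n)`, but fewer than `2^{p(n)+1}` strings have `Kt ≤ p(n)`
(`gapMKtP_count`).  The affine twin of `not_searchMKtPSolvableAt_of_le` (gates). [folklore] -/
theorem not_searchMKtPSolvableAt_formulaXor (U : UniversalMachine) {p t : ℕ → ℕ} {n : ℕ}
    (hyes : ones n ∈ U.MKtP p) (h : p n + t n + 1 ≤ n) :
    ¬ SearchMKtPSolvableAt U (formulaXorFns t) p n := by
  classical
  intro hS
  obtain ⟨E, hE, hcomp⟩ := sliceFn_MKtP_mem_of_searchMKtPSolvableAt U hS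
  have hsol : E.SolvesPromise (U.gapMKtP p p) := by
    intro u
    have hu : E.eval u = (U.MKtP p).boolIndicator (List.ofFn u) := hcomp u
    refine ⟨fun hy => ?_, fun hn => ?_⟩
    · rw [hu]; exact (Set.mem_iff_boolIndicator _ _).1 hy
    · rw [hu]
      refine (Set.notMem_iff_boolIndicator _ _).1 fun hy => ?_
      rw [UniversalMachine.mem_gapMKtP_no_iff] at hn
      exact absurd (lt_of_lt_of_le hn hy) (lt_irrefl _)
  have hy : ∃ y : List Bool, y.length = n ∧ U.levinKt y ≤ p n := by
    refine ⟨ones n, by simp, ?_⟩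
    have h' : U.levinKt (ones n) ≤ (p (ones n).length : ℕ) := hyes
    simpa using h'
  obtain ⟨hyes', hlt⟩ := OliveiraPichSanthanam2019.gapMKtP_count U p p t hy h
  exact not_solvesPromise_of_xorLeafCount_le E hE.2.2.2 hyes' hlt hsol

/-- **`search-MKtP[p]`, KNOWN side against parity-leaf formulas.** For `p` in the regime of
Thm. 1.6 (`KtRegime p`) whose YES side eventually contains `1^n`, there is `β₀ < 1` such that for
every `β' ∈ (β₀, 1)`, `search-MKtP[p]` is not solved with `N − ⌈N^{β'}⌉` parity leaves per output
bit at any large length (item 2 with `C = EXP` needs `N · p(N)^k + k` parity leaves for every `k`).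
[cite: ChenJinWilliams2019, Thm. 1.6 item 2, Moreover clause (hypothesis shape; known side folklore)] -/
theorem searchMKtP_formulaXor_known_sublinear (U : UniversalMachine) {p : ℕ → ℕ} (hp : KtRegime p)
    (hyes : ∀ᶠ n : ℕ in atTop, ones n ∈ U.MKtP p) :
    ∃ β₀ : ℝ, β₀ < 1 ∧ ∀ β' : ℝ, β₀ < β' → β' < 1 → ∀ᶠ n : ℕ in atTop,
      ¬ SearchMKtPSolvableAt U (formulaXorFns fun N => N - ⌈(N : ℝ) ^ β'⌉₊) p n := by
  obtain ⟨c, hc1, hev⟩ := hp.2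
  refine ⟨max c 0, max_lt hc1 one_pos, fun β' hβ₀ hβ'1 => ?_⟩
  have hcβ' : c < β' := (le_max_left c 0).trans_lt hβ₀
  have hβ'0 : 0 < β' := (le_max_right c 0).trans_lt hβ₀
  filter_upwards [hev, hyes, eventually_powLogThreshold_add_le hcβ' hβ'0 hβ'1.le 0] with n hn hy hnum
  refine not_searchMKtPSolvableAt_formulaXor U hy ?_
  have hpn : p n ≤ UniversalMachine.powLogThreshold c 0 n := by
    refine (Nat.le_floor hn).trans ?_
    exact OliveiraPichSanthanam2019.powThreshold_le_powLogThreshold c 0 n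
  omega

/-- **The instance `p = ⌊n^β⌋`** (`0 < β < β' < 1`): `search-MKtP[n^β]` is not solved with
`N − ⌈N^{β'}⌉` parity leaves per output bit at any large length — unconditionally, for every
universal machine (`1^n ∈ MKtP[n^β]` eventually, `eventually_ones_mem_MKtP_powThreshold`). [folklore] -/
theorem eventually_not_searchMKtPSolvableAt_formulaXor_powThreshold (U : UniversalMachine) {β β' : ℝ}
    (hβ : 0 < β) (hββ' : β < β') (hβ'1 : β' < 1) :
    ∀ᶠ n : ℕ in atTop, ¬ SearchMKtPSolvableAt U (formulaXorFns fun N => N - ⌈(N : ℝ) ^ β'⌉₊)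
      (UniversalMachine.powThreshold β) n := by
  obtain ⟨N₀, hN₀⟩ := U.eventually_ones_mem_MKtP_powThreshold hβ
  filter_upwards [eventually_ge_atTop N₀,
    eventually_powLogThreshold_add_le hββ' (hβ.trans hββ') hβ'1.le 0] with n hn hnum
  refine not_searchMKtPSolvableAt_formulaXor U (hN₀ n hn) ?_
  have := OliveiraPichSanthanam2019.powThreshold_le_powLogThreshold β 0 n
  omega

end ChenJinWilliams2019

end Literature.Computability.MetaComplexity
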